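import Summits.Ventures.PercRepro.ProfilePointedCircuitClassesStarSharpD0U

/-!
# PercRepro — CASE D0 OF `StarNineSharp`, PART V: THE TWO LOCAL LEMMAS OF THE `ef`-PLANE CLASS
(p5, gen 55; `proofs/P5-GM1.md` §82 (b))

* `not_both_lines_on`: for a `b`-generic `b` (`ρ{t, b, b′} = 3`) and a non-collinear triple `{x, y, t}`, the lines
  `{x, t}` and `{y, t}` are not both ON (two ON lines through `t` would put `b` in the closure of `{t, b′}`);
* `off_triple_of_line_off`: an OFF line `{y, z}` of the ON plane `H` stays OFF when a point `w ∉ H` is added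
  (`ρ({y, z, w} ∪ {b, b′}) = 5`) — the cut lemma of part U;
* the set identities used by parts W and X, proved here in an empty context (`tauto` is slow inside a proof context
  carrying thirty hypotheses).
-/

open scoped Matroid

namespace PercRepro.Cogirth

open Finset ThmH Skew Shadow Profile

open Classical

variable {α : Type} [DecidableEq α] {N : Matroid α} [N.Finite]

section StarSharpD0V

variable {b b' : α}

/-- For a `b`-generic `b` (`ρ{t, b, b′} = 3`) and a non-collinear trace `T = {x, y, t}`, the lines `{x, t}` and
`{y, t}` are not both ON (two ON lines through `t` would put `b` in the closure of `{t, b′}`). -/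
theorem not_both_lines_on (h : SeriesPair N b b') {x y t : α}
    (hx : x ∈ ((gr N).erase b).erase b') (hy : y ∈ ((gr N).erase b).erase b') (ht : t ∈ ((gr N).erase b).erase b')
    (hbg : rk N {t, b, b'} = 3) (hT3 : rk N {x, y, t} = 3) :
    ¬ (rk N (insert b (insert b' {x, t})) = 3 ∧ rk N (insert b (insert b' {y, t})) = 3) := by
  rintro ⟨h1, h2⟩
  have hsub := rk_union_add_rk_le_of_subset_inter' (N := N) (S := insert b (insert b' ({x, t} : Finset α)))
    (T := insert b (insert b' ({y, t} : Finset α))) (I := ({t, b, b'} : Finset α)) (by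
      intro z hz
      simp only [mem_insert, mem_singleton] at hz
      rcases hz with rfl | rfl | rfl
      · exact mem_inter.2 ⟨mem_insert_of_mem (mem_insert_of_mem (mem_insert_of_mem (mem_singleton_self _))),
          mem_insert_of_mem (mem_insert_of_mem (mem_insert_of_mem (mem_singleton_self _)))⟩
      · exact mem_inter.2 ⟨mem_insert_self _ _, mem_insert_self _ _⟩
      · exact mem_inter.2 ⟨mem_insert_of_mem (mem_insert_self _ _), mem_insert_of_mem (mem_insert_self _ _)⟩)
  have e1 : insert b (insert b' ({x, t} : Finset α)) ∪ insert b (insert b' ({y, t} : Finset α)) =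
      insert b (insert b' ({x, y, t} : Finset α)) := by
    ext z; simp only [mem_union, mem_insert, mem_singleton]; tauto
  rw [e1, h1, h2, hbg] at hsub
  have hb := rk_insert_bb'_bounds h (S := ({x, y, t} : Finset α)) (by
    intro z hz
    simp only [mem_insert, mem_singleton] at hz
    rcases hz with rfl | rfl | rfl <;> assumption)
  omega

/-- **AN OFF LINE OF THE TRACE STAYS OFF WHEN A POINT OFF `H` IS ADDED**: for `y, z ∈ H` with `ρ{y, z} = 2`, the line
`{y, z}` OFF, and `w ∉ H`, the triple `{y, z, w}` is OFF (`ρ({y, z, w} ∪ {b, b′}) = 5`): an ON triple would meet the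
ON plane `H` in the line `{y, z}` with a rank-4 union (the cut lemma). -/
theorem off_triple_of_line_off (h : SeriesPair N b b') (hR : rk N (gr N) = 5)
    (hE7 : rk N (((gr N).erase b).erase b') = 4)
    {H : Finset α} (hH : H ⊆ ((gr N).erase b).erase b') (hH3 : rk N H = 3)
    (hHon : rk N (insert b (insert b' H)) = 4)
    (hHfl : ∀ z ∈ ((gr N).erase b).erase b', z ∉ H → rk N (insert z H) = 4)
    {y z w : α} (hy : y ∈ ((gr N).erase b).erase b') (hyH : y ∈ H) (hz : z ∈ ((gr N).erase b).erase b') (hzH : z ∈ H)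
    (hw : w ∈ ((gr N).erase b).erase b') (hwH : w ∉ H)
    (hyz : rk N {y, z} = 2) (hoff : rk N (insert b (insert b' {y, z})) ≠ 3) :
    rk N (insert b (insert b' {y, z, w})) = 5 := by
  have hE7g : ((gr N).erase b).erase b' ⊆ gr N := (erase_subset _ _).trans (erase_subset _ _)
  have hS : ({y, z, w} : Finset α) ⊆ ((gr N).erase b).erase b' := by
    intro a ha; simp only [mem_insert, mem_singleton] at ha
    rcases ha with rfl | rfl | rfl <;> assumption
  have e1 : ({y, z, w} : Finset α) = insert w {y, z} := by
    ext a; simp only [mem_insert, mem_singleton]; tauto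
  have hyzH : ({y, z} : Finset α) ⊆ H := by
    intro a ha; simp only [mem_insert, mem_singleton] at ha
    rcases ha with rfl | rfl <;> assumption
  have h3 : rk N ({y, z, w} : Finset α) = 3 := by
    rw [e1, rk_insert_eq_add_one_of_subset_flat (N := N) (H := H) (S := ({y, z} : Finset α)) (z := w) (hE7g hw)
      (hH.trans hE7g) hyzH (by rw [hHfl w hw hwH, hH3]), hyz]
  apply rk_insert_bb'_eq_five_of_not_on h hS h3
  intro hon
  have hU : rk N (({y, z, w} : Finset α) ∪ H) = 4 := by
    apply le_antisymm
    · calc rk N (({y, z, w} : Finset α) ∪ H) ≤ rk N (((gr N).erase b).erase b') := rk_mono' (union_subset hS hH)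
        _ = 4 := hE7
    · calc 4 = rk N (insert w H) := (hHfl w hw hwH).symm
        _ ≤ rk N (({y, z, w} : Finset α) ∪ H) := rk_mono' (insert_subset
            (mem_union_left _ (mem_insert_of_mem (mem_insert_of_mem (mem_singleton_self _)))) subset_union_right)
  have hL : ({y, z} : Finset α) ⊆ ({y, z, w} : Finset α) ∩ H := by
    intro a ha; simp only [mem_insert, mem_singleton] at ha
    rcases ha with rfl | rfl
    · exact mem_inter.2 ⟨mem_insert_self _ _, hyH⟩
    · exact mem_inter.2 ⟨mem_insert_of_mem (mem_insert_self _ _), hzH⟩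
  exact hoff (on_line_of_two_on_planes h hR hS hH hon hHon hU hL hyz)


/-! ### Set identities (proved in an empty context — `tauto` is slow inside the main proof's context) -/

/-- `{p, q, r} = insert r {p, q}`. -/
theorem triple_eq_insert_last (p q r : α) : ({p, q, r} : Finset α) = insert r {p, q} := by
  ext a; simp only [mem_insert, mem_singleton]; tauto

/-- `{p, r, q} = {p, q, r}`. -/
theorem triple_swap23 (p q r : α) : ({p, r, q} : Finset α) = {p, q, r} := by
  ext a; simp only [mem_insert, mem_singleton]; tauto

/-- `{q, r, p} = {p, q, r}`. -/
theorem triple_rot' (p q r : α) : ({q, r, p} : Finset α) = {p, q, r} := by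
  ext a; simp only [mem_insert, mem_singleton]; tauto

/-- `{p, q, r} ⊆ {p, q, r, s}`. -/
theorem triple_subset_quad (p q r s : α) : ({p, q, r} : Finset α) ⊆ {p, q, r, s} := by
  intro a ha; simp only [mem_insert, mem_singleton] at ha ⊢; tauto

/-- `{p, q} ⊆ {p, q, r, s}`. -/
theorem pair_subset_quad (p q r s : α) : ({p, q} : Finset α) ⊆ {p, q, r, s} := by
  intro a ha; simp only [mem_insert, mem_singleton] at ha ⊢; tauto

/-- `insert z {x, y, w, w'} = {x, y, z, w, w'}`. -/
theorem insert_quad_eq (x y z w w' : α) : insert z ({x, y, w, w'} : Finset α) = {x, y, z, w, w'} := by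
  ext a; simp only [mem_insert, mem_singleton]; tauto

/-- `insert r {p, q, s} = {p, q, r, s}`. -/
theorem insert_triple_eq_quad (p q r s : α) : insert r ({p, q, s} : Finset α) = {p, q, r, s} := by
  ext a; simp only [mem_insert, mem_singleton]; tauto

/-- `insert e {x, y} ⊆ insert y (insert x {e, f})`. -/
theorem insert_pair_subset_insert_insert (e f x y : α) :
    insert e ({x, y} : Finset α) ⊆ insert y (insert x {e, f}) := by
  intro a ha; simp only [mem_insert, mem_singleton] at ha ⊢; tauto

/-- `insert f {e, z} = {e, f, z}`. -/
theorem insert_pair_eq_mid (e f z : α) : insert f ({e, z} : Finset α) = {e, f, z} := by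
  ext a; simp only [mem_insert, mem_singleton]; tauto

/-- `insert e {f, z} = {e, f, z}`. -/
theorem insert_pair_eq_first (e f z : α) : insert e ({f, z} : Finset α) = {e, f, z} := rfl

/-- `{e, z} ⊆ insert e {z, w, w'}`. -/
theorem pair_subset_insert_triple (e z w w' : α) : ({e, z} : Finset α) ⊆ insert e {z, w, w'} := by
  intro a ha; simp only [mem_insert, mem_singleton] at ha ⊢; tauto

/-- `{f, z} ⊆ insert z (insert f {x, y})`. -/
theorem pair_subset_insert_insert_pair (f z x y : α) : ({f, z} : Finset α) ⊆ insert z (insert f {x, y}) := by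
  intro a ha; simp only [mem_insert, mem_singleton] at ha ⊢; tauto

/-- `{f, p} ⊆ insert f {p, q}`. -/
theorem pair_subset_insert_pair (f p q : α) : ({f, p} : Finset α) ⊆ insert f {p, q} := by
  intro a ha; simp only [mem_insert, mem_singleton] at ha ⊢; tauto

/-- `{x, y} ⊆ {x, y, w, w'} ∩ H` when `x, y ∈ H`. -/
theorem pair_subset_quad_inter {H : Finset α} {x y : α} (hx : x ∈ H) (hy : y ∈ H) (w w' : α) :
    ({x, y} : Finset α) ⊆ ({x, y, w, w'} : Finset α) ∩ H := by
  intro a ha; simp only [mem_insert, mem_singleton] at ha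
  rcases ha with rfl | rfl
  · exact mem_inter.2 ⟨mem_insert_self _ _, hx⟩
  · exact mem_inter.2 ⟨mem_insert_of_mem (mem_insert_self _ _), hy⟩

end StarSharpD0V

end PercRepro.Cogirth
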